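import Mathlib
import HarnessLib
import Literature.ModelTheory.FiniteModelTheory.StructCkEquiv
import Summits.ValiantsHypothesis.ValiantsHypothesis.Theorems.SymmetryDialAffinePebble
import Summits.ValiantsHypothesis.ValiantsHypothesis.Theorems.SymmetryDialDisalignedCFI
import Summits.ValiantsHypothesis.ValiantsHypothesis.Theorems.SymmetryDialDisalignedCFIShear
import Summits.ValiantsHypothesis.ValiantsHypothesis.Theorems.SymmetryDialShearStrategy
import Summits.ValiantsHypothesis.ValiantsHypothesis.Theorems.SymmetryDialShearInvariant
import Summits.ValiantsHypothesis.ValiantsHypothesis.Theorems.SymmetryDialShearGame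
import Summits.ValiantsHypothesis.ValiantsHypothesis.Theorems.SymmetryDialCondScheme
import Summits.ValiantsHypothesis.ValiantsHypothesis.Theorems.SymmetryDialKeyedScheme

/-!
# Symmetry dial — the PAIR-KEYED protection scheme (NODE-g10 §5–§6, lens 1, g10)

NODE-g10 proves (on paper, with finite design checks that were run) a ONE-PIN RIGIDITY LEMMA for the
`d = 135` hyperplane-coset designs: in a configuration with one pinned point `p` and pebbled duals `B`,
an edge set whose coboundary-change functional is frozen has its active vertices in an affine flat of
dimension `≤ |B|` through `p`.  For `|B| = 2` the flat is a SQUARE `Q = p – x – o – y`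
(`x = p + g_c`, `y = p + g_a`, `o = p + g_a + g_c`), the frozen sets are the `x ⊆ Q` with `|x| ≥ 2`
meeting `{(x,o), (y,o)}`, and the frozen plane is `Σ(Q,p,x) = ⟨A + C, B + C⟩ ∋ A + B`, where
`A, B, C` are the sums of the `x`-slot values at `x, y, o` — its three non-zero elements are exactly
the g9 square key `A + B` and the two prism keys `B + C`, `A + C` of `SymmetryDialKeyedScheme.keyed`.
Consequence (verified by the exact rank test on both designs, 198/198 configurations): the keyed
scheme `protKey`, which has no keys while nothing is pinned, FAILS its own linear condition at
`(({p}, basis of Σ(Q,p,x)), latest p)` — Duplicator must clean such `x` already at level `(∅, {β, β'})`.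
The repair ported here from `asc4k2.py` is the level-0 PAIR KEY: for every two pebbled duals
`β ≠ β'` and every positional `(Q,p,x)` with `span{β, β'} = Σ(Q,p,x)`, the edges of `x` are protected.
`protPK = protKey ∪ pair keys` still contains the stars and is empty on the empty board, so the kernel
theorem `SymmetryDialShearGame.affinePebbleEquiv_of_linear'` instantiates:
`affinePebbleEquiv_of_condLinPK`.
-/

set_option linter.dupNamespace false

namespace Summit.ValiantsHypothesis.ValiantsHypothesis.Theorems.SymmetryDialPairKeyedScheme

open Literature.ModelTheory.FiniteModelTheory
open SymmetryDialAffinePebble (V pair Laff affStr AffinePebbleEquiv)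
open SymmetryDialDisalignedCFI (base fib Design cfiMat)
open SymmetryDialDisalignedCFIShear (cobd transp)
open SymmetryDialShearStrategy (ShearParam)
open SymmetryDialShearInvariant (Pos)
open SymmetryDialShearGame (affinePebbleEquiv_of_linear')
open SymmetryDialCondScheme (pinned dualPeb pinned_of_mem pinned_empty dualPeb_empty)
open SymmetryDialKeyedScheme (sw protKey protKey_of_pinned_left protKey_of_pinned_right protKey_empty)

variable {d₀ r δ : ℕ}

/-! ## §1 Positional squares and their key triple -/

/-- Slot sum `A` at the corner `x = p + g_c` of the square `(p; a, c)` for the edge subset with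
membership flags `η₁` (edge `(p,x)`, label `c`) and `η₃` (edge `(x,o)`, label `a`). -/
def slotX (D : Design d₀ r δ) (p : V d₀) (a c : Fin δ) (η₁ η₃ : Bool) : V r :=
  sw η₁ (D.lam (p + D.gen c) c) + sw η₃ (D.lam (p + D.gen c) a)

/-- Slot sum `B` at the corner `y = p + g_a` (flags `η₂`: edge `(p,y)`, label `a`; `η₄`: edge
`(y,o)`, label `c`). -/
def slotY (D : Design d₀ r δ) (p : V d₀) (a c : Fin δ) (η₂ η₄ : Bool) : V r :=
  sw η₂ (D.lam (p + D.gen a) a) + sw η₄ (D.lam (p + D.gen a) c)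

/-- Slot sum `C` at the far corner `o = p + g_a + g_c` (flags `η₃`: edge `(x,o)`, label `a`; `η₄`:
edge `(y,o)`, label `c`). -/
def slotO (D : Design d₀ r δ) (p : V d₀) (a c : Fin δ) (η₃ η₄ : Bool) : V r :=
  sw η₃ (D.lam (p + D.gen a + D.gen c) a) + sw η₄ (D.lam (p + D.gen a + D.gen c) c)

/-- The edge subset of the square `(p; a, c)` flagged by `η₁ … η₄` is ADMISSIBLE for a pair key:
`|x| ≥ 2` and `x` meets `{(x,o), (y,o)}` (`|x| = 1` is the `E_span` case, already in `protAsc`). -/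
def pkFlags (η₁ η₂ η₃ η₄ : Bool) : Bool :=
  (η₃ || η₄) && (η₁ || η₂ || (η₃ && η₄))

/-- `(v, w)` is one of the flagged edges `(p,x)`, `(p,y)`, `(x,o)`, `(y,o)` of the square `(p; a, c)`
(`x = p + g_c`, `y = p + g_a`, `o = p + g_a + g_c`). -/
def pkEdge (D : Design d₀ r δ) (p : V d₀) (a c : Fin δ) (η₁ η₂ η₃ η₄ : Bool) (v w : V d₀) : Bool :=
  decide ((η₁ = true ∧ v = p ∧ w = p + D.gen c) ∨
          (η₂ = true ∧ v = p ∧ w = p + D.gen a) ∨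
          (η₃ = true ∧ v = p + D.gen c ∧ w = p + D.gen a + D.gen c) ∨
          (η₄ = true ∧ v = p + D.gen a ∧ w = p + D.gen a + D.gen c))

/-- `β` lies in the key triple `{A + B, B + C, A + C}` of the flagged edge subset of the square
`(p; a, c)` (square key, prism-`x` key, prism-`y` key of NODE-g9 §B.15). -/
def pkTriple (D : Design d₀ r δ) (p : V d₀) (a c : Fin δ) (η₁ η₂ η₃ η₄ : Bool) (β : V r) : Bool :=
  decide (β = slotX D p a c η₁ η₃ + slotY D p a c η₂ η₄ ∨
          β = slotY D p a c η₂ η₄ + slotO D p a c η₃ η₄ ∨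
          β = slotX D p a c η₁ η₃ + slotO D p a c η₃ η₄)

/-- `PK(β₁, β₂) ∋ (v, w)` (`asc4k2.DesignK2.pk_pair`): there is a square `(p; a, c)`, `a ≠ c`, and an
admissible edge subset `x` (flags `η₁ … η₄`) such that `(v, w)` is an edge of `x` and `β₁ ≠ β₂` are
two non-zero elements of the key triple `{A + B, B + C, A + C}` of `(Q, p, x)` — equivalently (as
`(A + B) + (B + C) = A + C`) `span{β₁, β₂} = Σ(Q,p,x)`, the plane frozen by the pair once `p` is
pinned (NODE-g10 Thm 1 / Lemma 3). -/
def pairKeyed (D : Design d₀ r δ) (β₁ β₂ : V r) (v w : V d₀) : Bool :=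
  decide (β₁ ≠ β₂ ∧ β₁ ≠ 0 ∧ β₂ ≠ 0 ∧
    ∃ (p : V d₀) (a c : Fin δ) (η₁ η₂ η₃ η₄ : Bool), a ≠ c ∧ pkFlags η₁ η₂ η₃ η₄ = true ∧
      pkEdge D p a c η₁ η₂ η₃ η₄ v w = true ∧
      pkTriple D p a c η₁ η₂ η₃ η₄ β₁ = true ∧ pkTriple D p a c η₁ η₂ η₃ η₄ β₂ = true)

/-! ## §2 The pair-keyed scheme -/

/-- `Prot⁺` of `asc4k2.py`: `protKey` together with, for every two pebbled duals `β₁, β₂`, the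
pair-keyed edges (either orientation).  Pair keys need no pin: they are the level-`(∅, {β, β'})`
look-ahead that `protKey` lacks. -/
def protPK (k : ℕ) (D : Design d₀ r δ) (s : Pos k (d₀ + r)) (v w : V d₀) : Bool :=
  protKey k D s v w ||
    decide (∃ β₁ β₂ : V r, dualPeb s β₁ = true ∧ dualPeb s β₂ = true ∧
      (pairKeyed D β₁ β₂ v w = true ∨ pairKeyed D β₁ β₂ w v = true))

/-- Stars are protected (left end pinned). -/
theorem protPK_of_pinned_left {k : ℕ} (D : Design d₀ r δ) (s : Pos k (d₀ + r)) (v w : V d₀)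
    (h : pinned s v = true) : protPK k D s v w = true := by
  unfold protPK; rw [protKey_of_pinned_left D s v w h]; rfl

/-- Stars are protected (right end pinned). -/
theorem protPK_of_pinned_right {k : ℕ} (D : Design d₀ r δ) (s : Pos k (d₀ + r)) (v w : V d₀)
    (h : pinned s w = true) : protPK k D s v w = true := by
  unfold protPK; rw [protKey_of_pinned_right D s v w h]; rfl

/-- Nothing is protected on the empty board (pair keys need two pebbled duals). -/
theorem protPK_empty {k : ℕ} (D : Design d₀ r δ) (v w : V d₀) :
    protPK k D (fun _ : Fin k => (none : Option (V (d₀ + r) ⊕ V (d₀ + r)))) v w = false := by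
  unfold protPK
  rw [protKey_empty, Bool.false_or, decide_eq_false_iff_not]
  rintro ⟨β₁, β₂, hβ, -, -⟩
  rw [dualPeb_empty] at hβ
  exact Bool.false_ne_true hβ

/-- `protPK` refines `protKey`: every keyed-scheme-protected edge stays protected (MONO in the scheme
direction; the certificate's KEEP/CLEAR bookkeeping relies on it). -/
theorem protPK_of_protKey {k : ℕ} (D : Design d₀ r δ) (s : Pos k (d₀ + r)) (v w : V d₀)
    (h : protKey k D s v w = true) : protPK k D s v w = true := by
  unfold protPK; rw [h]; rfl

/-! ## §3 (S4) for the pair-keyed scheme, modulo its linear condition -/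

/-- **(S4) for the pair-keyed scheme.**  For a Good framed Cayley design, any decoration and SYMMETRIC
twists, `𝔄(cfiMat D S t) ≡_{C^k} 𝔄(cfiMat D S t')` as soon as the linear re-clearing condition of
the scheme `protPK k D` holds (the existence form, over positions, of the certificate `COND⁺_k(D)` of
`asc4k2.py`; NODE-g10 §7 pre-registers the finite enumeration that decides it at `k = 4` on the
`d = 135` designs). -/
theorem affinePebbleEquiv_of_condLinPK {k : ℕ} (D : Design d₀ r δ) (hD : D.Good)
    (S : V d₀ → V r → Bool) (t t' : V d₀ → V d₀ → Fin 2)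
    (ht : ∀ v w, t v w = t w v) (ht' : ∀ v w, t' v w = t' w v)
    (hlin : ∀ (s : Pos k (d₀ + r)) (i i₀ : Fin k) (d : V d₀ → V d₀ → Fin 2), (∀ v w, d v w = d w v) →
      ∃ (ΔL : V d₀ → V r) (Δc : V r),
        (∀ v w, ΔL (v + w) = ΔL v + ΔL w) ∧
        (∀ j, j ≠ i → ∀ x, s j = some (.inl x) → ΔL (base x) + Δc = 0) ∧
        (∀ j, j ≠ i → ∀ ξ, s j = some (.inr ξ) → transp ΔL (fib ξ) = 0) ∧
        (∀ (v : V d₀) (idx : Fin δ), protPK k D (Function.update s i none) v (v + D.gen idx) = true →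
          (protPK k D (Function.update s i₀ none) v (v + D.gen idx) = true →
            cobd D (fun u => ΔL u + Δc) v (v + D.gen idx) = 0) ∧
          (¬ protPK k D (Function.update s i₀ none) v (v + D.gen idx) = true →
            cobd D (fun u => ΔL u + Δc) v (v + D.gen idx) = d v (v + D.gen idx)))) :
    AffinePebbleEquiv k (d₀ + r) (cfiMat D S t) (cfiMat D S t') := by
  refine affinePebbleEquiv_of_linear' D hD S t t' ht ht' (fun s v w => protPK k D s v w = true)
    (fun v w h => ?_) (fun s v w hpin => ?_) hlin
  · rw [protPK_empty] at h; exact Bool.false_ne_true h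
  · obtain ⟨j, x, hj, rfl⟩ := hpin
    exact ⟨protPK_of_pinned_left D s _ w (pinned_of_mem s j x hj),
      protPK_of_pinned_right D s w _ (pinned_of_mem s j x hj)⟩

end Summit.ValiantsHypothesis.ValiantsHypothesis.Theorems.SymmetryDialPairKeyedScheme
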